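import Summits.Schanuel.Schanuel.Theses.RootDecomp1H
import Literature.NumberTheory.Transcendental.ZilberFieldHomogeneity
import Literature.ModelTheory.ExponentialFields.Languages

/-!
# RootDecomp1HProductCells — the GLUE ITEM of the round-3 split of `BridgeCS` (route RootDecomp1H, lens-5 cell decomp-schanuel)

`BridgeCSGlue : ProductSchanuel → BridgeCoupled → BridgeCS`: at a near-`c⋆`-optimal conjugation-stable first failure `y`, either
the `ℚ`-span of `y` has a basis `u` of depth-one numbers — then `u` is a counterexample too (counterexample-ness is a property of the
span: the coordinates of `(u, e^u)` are algebraic over `ℚ(y, e^y)` and conversely, Kirby's `Γ`-field closure `gens_sup_span_subset_acl`,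
read through the algebraic matroid of `ℂ`), contradicting `ProductSchanuel` — or it has none, and `BridgeCoupled` answers. No `Prop`
definitions; the only non-support declaration is the final theorem (item stmt-Schanuel-28263).
Port of the lens-5 hand-off `HOME/decomp-schanuel-lens-5/g3/prover/RootDecomp1HProductCells.port.lean` (critic CLEARED
the node 2026-08-30T05:01:35Z and the typed route rev 2–3 at 05:13:34Z) by the census seat; 0 sorry.
-/

noncomputable section

set_option linter.dupNamespace false

namespace Summit.Schanuel.Schanuel.Theorems.RootDecomp1HProductCells

open Complex Set
open Literature.NumberTheory.Transcendental
open Literature.NumberTheory.Transcendental.GammaField Literature.ModelTheory.ExponentialFields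
open Summit.Schanuel.Schanuel.Theses.RootDecomp1H

variable {n : ℕ}

/-- The coordinates of `(y, e^y)` are in the algebraic closure of `(x, eˣ)` when `span_ℚ x = span_ℚ y`. -/
theorem range_subset_acl_of_span_eq {x y : Fin n → ℂ}
    (h : Submodule.span ℚ (range x) = Submodule.span ℚ (range y)) :
    range y ∪ range (cexp ∘ y) ⊆ acl (range x ∪ range (cexp ∘ x)) := by
  have key := gens_sup_span_subset_acl (⊥ : Submodule ℚ ℂ) (range x)
  rw [bot_sup_eq] at key
  have h2 : acl (gens (⊥ : Submodule ℚ ℂ) ∪ (range x ∪ exp '' range x)) ⊆ acl (range x ∪ range (cexp ∘ x)) := by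
    refine acl_subset_acl_of_subset ?_
    rintro b (hb | hb)
    · rcases mem_gens_iff.1 hb with hb | ⟨z, hz, rfl⟩
      · rw [(Submodule.mem_bot ℚ).1 hb]; exact zero_mem_acl _
      · rw [(Submodule.mem_bot ℚ).1 hz, ExponentialRing.exp_zero]; exact one_mem_acl _
    · refine subset_acl _ ?_
      simpa [Set.range_comp] using hb
  intro b hb
  refine h2 (key ?_)
  rw [h]
  rcases hb with ⟨i, rfl⟩ | ⟨i, rfl⟩
  · exact mem_gens_of_mem (Submodule.subset_span ⟨i, rfl⟩)
  · have hyi : y i ∈ Submodule.span ℚ (range y) := Submodule.subset_span ⟨i, rfl⟩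
    have := exp_mem_gens hyi
    simpa using this

/-- Same span ⟹ the rank of `(y, e^y)` in the algebraic matroid is at most that of `(x, eˣ)`. -/
theorem eRk_le_of_span_eq {x y : Fin n → ℂ} (h : Submodule.span ℚ (range x) = Submodule.span ℚ (range y)) :
    (algMatroid ℂ).eRk (range y ∪ range (cexp ∘ y)) ≤ (algMatroid ℂ).eRk (range x ∪ range (cexp ∘ x)) :=
  calc (algMatroid ℂ).eRk (range y ∪ range (cexp ∘ y)) ≤ (algMatroid ℂ).eRk (acl (range x ∪ range (cexp ∘ x))) :=
        (algMatroid ℂ).eRk_mono (range_subset_acl_of_span_eq h)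
    _ = (algMatroid ℂ).eRk (range x ∪ range (cexp ∘ x)) := (algMatroid ℂ).eRk_closure_eq _

/-- Rank `≥ n` in the algebraic matroid gives transcendence degree `≥ n` of the generated field. -/
theorem le_trdeg_of_natCast_le_eRk {T : Set ℂ} {m : ℕ} (h : (m : ℕ∞) ≤ (algMatroid ℂ).eRk T) :
    (m : Cardinal) ≤ Algebra.trdeg ℚ ↥(IntermediateField.adjoin ℚ T) := by
  classical
  set M := algMatroid ℂ
  set E₁ : IntermediateField ℚ ℂ := IntermediateField.adjoin ℚ T
  obtain ⟨I, hI⟩ := M.exists_isBasis T (subset_univ _)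
  have hIT : I ⊆ T := hI.subset
  have hcard : (m : ℕ∞) ≤ I.encard := by rw [hI.encard_eq_eRk]; exact h
  have hAI : AlgebraicIndepOn ℚ id I := AlgebraicIndependent.matroid_indep_iff.1 hI.indep
  let v : I → E₁ := fun a => ⟨a, IntermediateField.subset_adjoin ℚ T (hIT a.2)⟩
  have hv : AlgebraicIndependent ℚ v := AlgebraicIndependent.of_comp E₁.val hAI
  have h1 : Cardinal.mk I ≤ Algebra.trdeg ℚ E₁ := hv.cardinalMk_le_trdeg
  refine le_trans ?_ h1
  by_cases hfin : I.Finite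
  · have : (m : ℕ∞) ≤ (I.ncard : ℕ∞) := by rwa [hfin.cast_ncard_eq]
    have hn : m ≤ I.ncard := by exact_mod_cast this
    calc (m : Cardinal) ≤ (I.ncard : Cardinal) := by exact_mod_cast hn
      _ = Cardinal.mk I := Set.cast_ncard hfin
  · have : Infinite I := Set.infinite_coe_iff.2 hfin
    exact (Cardinal.natCast_lt_aleph0 (n := m)).le.trans (Cardinal.aleph0_le_mk I)

/-- The transcendence defect transports along the span: if `span_ℚ y = span_ℚ u` and `trdeg ℚ(y, e^y) < n` then `trdeg ℚ(u, e^u) < n`. -/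
theorem trdeg_lt_of_span_eq {y u : Fin n → ℂ} (h : Submodule.span ℚ (range y) = Submodule.span ℚ (range u))
    (hy : Algebra.trdeg ℚ ↥(IntermediateField.adjoin ℚ (range y ∪ range (cexp ∘ y))) < (n : Cardinal)) :
    Algebra.trdeg ℚ ↥(IntermediateField.adjoin ℚ (range u ∪ range (cexp ∘ u))) < (n : Cardinal) := by
  by_contra hge
  push Not at hge
  have h1 := ZilberHomogeneity.natCast_le_eRk_of_le_trdeg hge
  have h2 : (n : ℕ∞) ≤ (algMatroid ℂ).eRk (range y ∪ range (cexp ∘ y)) := h1.trans (eRk_le_of_span_eq h)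
  exact absurd hy (not_lt.2 (le_trdeg_of_natCast_le_eRk h2))

/-- **The glue item of the split** `BridgeCS ⟸ ProductSchanuel ∧ BridgeCoupled`. -/
theorem bridgeCSGlue_holds : BridgeCSGlue := by
  intro hPS hBC n c hlow y hopt hcs hce
  by_cases hprod : ∃ u : Fin n → ℂ, LinearIndependent ℚ u ∧
      (∀ j, Algebra.trdeg ℚ ↥(IntermediateField.adjoin ℚ ({u j, Complex.exp (u j)} : Set ℂ)) ≤ 1) ∧
      Submodule.span ℚ (Set.range y) = Submodule.span ℚ (Set.range u)
  · obtain ⟨u, hu, hdep, hyu⟩ := hprod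
    exact absurd (hPS n u hdep hu) (not_le.2 (trdeg_lt_of_span_eq hyu hce.2))
  · exact hBC n c hlow y hopt hcs hce hprod

end Summit.Schanuel.Schanuel.Theorems.RootDecomp1HProductCells
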